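import Summits.Ventures.CertifiedManyBodySolver.Downfold.EmeryVanHoveSubBox
import Summits.Ventures.CertifiedManyBodySolver.Downfold.EmeryVanHoveTableC
import Summits.Ventures.CertifiedManyBodySolver.Downfold.EmeryVanHoveTableF
import Summits.Ventures.CertifiedManyBodySolver.Downfold.EmeryBoxesKSlicesB
import HarnessLib

/-!
# YBa₂Cu₃O₆.₀₀ (M64, #139 bilayer PARENT) plane Cu(2), (K) source rows: the CERTIFIED van Hove (Lifshitz) hole doping of the σ three-band model on the typed 3BE one-body box
# — `x_VH ∈ [0.2139, 0.2974]`

Venture CertifiedManyBodySolver, cell `pub/hubbard-downfold` (stage S1, HUMAN RULINGS D-0096/D-0098: the three-band → one-band reduction error is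
carried explicitly), seat hubbard-downfold-mod-4 (technique B = band level); namespace `Summit.Ventures.CertifiedManyBodySolver.Downfold.Emery`.
Everything PROVED; numerics decided by the kernel (ONE `vhBoxCheck` + two entries of the certified table of `Ψ`, `EmeryVanHoveTableC/F`).

DEVICE (`EmeryVanHoveFactorisation` / `EmeryVanHoveSubBox`): the σ-model van Hove hole doping `x_VH = 1 − 2·abFilling(ε_VH)` (the hole count per Cu,
relative to the half-filled antibonding band, at which the Fermi level reaches the saddle point `ε_AB(X)`) FACTORISES as `x_VH = 1 − 2Ψ(q)`,
`q = u(1 + u)`, **`u = 2(t_pp + t_pp′)/(Δ_pd + ε_VH)`**, with `Ψ` universal and antitone; `u` is monotone in each band parameter, so the window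
below is CORNER-EXACT up to the table resolution (±0.005 per side, `K = 384` grid).

THE STATEMENT (`yBCO6Box_xVH`, typed words `emeryBoxYBCO6K26Src`). For every parameter vector of the box
Δ_pd [2.04, 2.65] × t_pd [1.16, 1.37] × t_pp [0.61, 0.72] × t_pp′ [0.16, 0.2] (one-body rows of YBa₂Cu₃O₆.₀₀ (M64, #139 bilayer PARENT) plane Cu(2), (K) source rows):
**ε_VH ∈ [1.166, 1.71]** (eV above ε_d), **Δ_pd + ε_VH ∈ [3.34, 4.201]**, **q ∈ [0.5009, 0.8544]**
(i.e. the σ Fermi-surface `−t′/t` AT THE SADDLE ENERGY `ρ = q/(1 + 2q) ∈ [0.2502, 0.3154]`), `x_VH = 1 − 2Ψ(q)`, and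
**`x_VH ∈ [0.2139, 0.2974]`** (table entries `Ψ(1/2) ≤ 57961/147456`, `Ψ(171/200) ≥ 51801/147456`).
Float truth at the two extreme corners (not a theorem): x_VH ∈ [0.2192, 0.2922].

READING (the box file's business; comparators are [float]): see the box file addendum / router/EMERY-FS-WINDOWS.md §x_VH.
WHAT THIS IS NOT: not a statement that the material's parameters ARE in the box (SCREENING-GRADE provenance); `U = 0` band kinematics of the σ
d–p_x–p_y(+t_pp, t_pp′) model; the identification of a material's LIFSHITZ transition with this one-body crossing is the consumer's modelling claim
(correlations and the axial / longer-range one-body channels both move it); no phase sentence. Sources: [HybertsenSchluterChristensen1989, Eq. (1)];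
[AndersenEtAl1995, §6]; [PavariniEtAl2001, Eq. (1)].
-/

noncomputable section

namespace Summit.Ventures.CertifiedManyBodySolver.Downfold.Emery

open Real Set
open Summit.Ventures.CertifiedManyBodySolver.Downfold

/-- **YBa₂Cu₃O₆.₀₀ (M64, #139 bilayer PARENT) plane Cu(2), (K) source rows — raw-coordinate van Hove certificate**: on Δ_pd [2.04, 2.65] × t_pd [1.16, 1.37] × t_pp [0.61, 0.72] × t_pp′ [0.16, 0.2]: `ε_VH ∈ [1.166, 1.71]`,
`q ∈ [0.5009, 0.8544]`, `x_VH = 1 − 2Ψ(q)` and `x_VH ∈ [0.2139, 0.2974]`. [folklore] -/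
theorem yBCO6Box_xVH {Δ tpd tpp c : ℝ} (hΔ : Δ ∈ Set.Icc (51 / 25 : ℝ) (53 / 20 : ℝ))
    (ha : tpd ∈ Set.Icc (29 / 25 : ℝ) (137 / 100 : ℝ)) (hb : tpp ∈ Set.Icc (61 / 100 : ℝ) (18 / 25 : ℝ))
    (hc : c ∈ Set.Icc (4 / 25 : ℝ) (1 / 5 : ℝ)) :
    vhEnergy Δ tpd c ∈ Set.Icc (583 / 500 : ℝ) (8551 / 5000 : ℝ) ∧ vhRatio Δ tpd tpp c ∈ Set.Icc (5009 / 10000 : ℝ) (534 / 625 : ℝ) ∧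
      xVH Δ tpd tpp c = 1 - 2 * vhFrac (vhRatio Δ tpd tpp c) ∧ xVH Δ tpd tpp c ∈ Set.Icc (15767 / 73728 : ℝ) (7309 / 24576 : ℝ) := by
  have h := xVH_window_of_vhBoxCheck
    (Δ₁ := ((51 : ℚ) / 25)) (Δ₂ := ((53 : ℚ) / 20)) (a₁ := ((29 : ℚ) / 25)) (a₂ := ((137 : ℚ) / 100)) (b₁ := ((61 : ℚ) / 100)) (b₂ := ((18 : ℚ) / 25))
    (c₁ := ((4 : ℚ) / 25)) (c₂ := ((1 : ℚ) / 5)) (v₁ := ((583 : ℚ) / 500)) (v₂ := ((8551 : ℚ) / 5000)) (e := ((13 : ℚ) / 10)) (E := ((15509 : ℚ) / 10000))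
    (q₁ := ((5009 : ℚ) / 10000)) (q₂ := ((534 : ℚ) / 625)) (by decide +kernel)
    (Δ := Δ) (tpd := tpd) (tpp := tpp) (c := c) (by simpa using hΔ) (by simpa using ha) (by simpa using hb) (by simpa using hc)
  obtain ⟨hv, -, hq, -, heq, hwin⟩ := h
  push_cast at hv hq hwin
  have hx := xVH_window_of_table hwin (qa := (1 / 2 : ℝ)) (qb := (171 / 200 : ℝ)) (by norm_num) (by norm_num) vhFrac_1_2.2 vhFrac_171_200.1
  exact ⟨⟨by linarith [hv.1], by linarith [hv.2]⟩, ⟨by linarith [hq.1], by linarith [hq.2]⟩, heq,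
    ⟨by linarith [hx.1], by linarith [hx.2]⟩⟩

/-- The four ONE-BODY rows of `emeryBoxYBCO6K26Src` (`EmeryBoxesKSlicesB`) this file reads. [folklore] -/
theorem emeryBoxYBCO6K26Src_oneBodyRows {p : EmeryCoord → ℝ} (hp : emeryBoxYBCO6K26Src.Mem p) :
    p .DeltaPd ∈ Set.Icc (51 / 25 : ℝ) (53 / 20 : ℝ) ∧ p .tpd ∈ Set.Icc (29 / 25 : ℝ) (137 / 100 : ℝ) ∧
      p .tpp ∈ Set.Icc (61 / 100 : ℝ) (18 / 25 : ℝ) ∧ p .tppP ∈ Set.Icc (4 / 25 : ℝ) (1 / 5 : ℝ) := by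
  have hΔ := (Entry.mem_ofEnds_iff _ _ _ _ _).1 (hp .DeltaPd ybco6K26Emery_DeltaKS rfl)
  have ha := (Entry.mem_ofEnds_iff _ _ _ _ _).1 (hp .tpd ybco6K26Emery_tpd rfl)
  have hb := (Entry.mem_ofEnds_iff _ _ _ _ _).1 (hp .tpp ybco6K26Emery_tpp rfl)
  have hc := (Entry.mem_ofEnds_iff _ _ _ _ _).1 (hp .tppP ybco6K26Emery_tppP rfl)
  push_cast at hΔ ha hb hc
  exact ⟨⟨hΔ.1, hΔ.2⟩, ⟨ha.1, ha.2⟩, ⟨hb.1, hb.2⟩, ⟨hc.1, hc.2⟩⟩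

/-- **THE WORD ON THE TYPED BOX `emeryBoxYBCO6K26Src`**: at every parameter vector the σ three-band van Hove (Lifshitz) hole doping lies in
`[0.2139, 0.2974]` (holes per Cu relative to the half-filled antibonding band). [cite: HybertsenSchluterChristensen1989, Eq. (1) (three-band d–p model)] -/
theorem emeryBoxYBCO6K26Src_xVH_window :
    HoldsOn (fun p : EmeryCoord → ℝ =>
      xVH (p .DeltaPd) (p .tpd) (p .tpp) (p .tppP) ∈ Set.Icc (15767 / 73728 : ℝ) (7309 / 24576 : ℝ)) emeryBoxYBCO6K26Src := by
  intro p hp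
  obtain ⟨hΔ, ha, hb, hc⟩ := emeryBoxYBCO6K26Src_oneBodyRows hp
  exact (yBCO6Box_xVH hΔ ha hb hc).2.2.2

/-- On `emeryBoxYBCO6K26Src`: the saddle energy `ε_VH ∈ [1.166, 1.71]` and the ratio `q ∈ [0.5009, 0.8544]` (`−t′/t` at the saddle energy
`∈ [0.2502, 0.3154]`). [folklore] -/
theorem emeryBoxYBCO6K26Src_vhEnergy_vhRatio_window :
    HoldsOn (fun p : EmeryCoord → ℝ =>
      vhEnergy (p .DeltaPd) (p .tpd) (p .tppP) ∈ Set.Icc (583 / 500 : ℝ) (8551 / 5000 : ℝ) ∧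
      vhRatio (p .DeltaPd) (p .tpd) (p .tpp) (p .tppP) ∈ Set.Icc (5009 / 10000 : ℝ) (534 / 625 : ℝ)) emeryBoxYBCO6K26Src := by
  intro p hp
  obtain ⟨hΔ, ha, hb, hc⟩ := emeryBoxYBCO6K26Src_oneBodyRows hp
  exact (yBCO6Box_xVH hΔ ha hb hc)|> fun h => ⟨h.1, h.2.1⟩

end Summit.Ventures.CertifiedManyBodySolver.Downfold.Emery
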